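import Summits.QuantumFields.YangMills.Theorems.FluctuationComparisonRegPrIntLS2BetaChartReadDescentDerivFactorisation
import Summits.QuantumFields.YangMills.Theorems.FluctuationComparisonRegPrIntLS2BetaChartReadDerivKStepSup
import HarnessLib

/-!
# S2β · (D2) AT THE ORGAN: `‖(DM ζ) B‖ ≤ (1 + 4·5)·exp(c₃·Σ_{i<K−J} (5L)²∕4·θ(K−i))·L^{K−J}·‖ζ‖_∞` for px5 g22's PINNED `DM` (the quaternion-read charted descent) at every good history
# — (D2) ✓`…ChartReadDerivKStepSup` read through (E) ✓`…ChartReadDescentDerivFactorisation` and the Pauli isometry `‖⟨su2Coord (rev x)⟩‖ = ‖x‖` (lit ✓`norm_quatMatrix`, ✓`norm_imQuat`)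

Cell `ym3-torus` (YM ladder rung R3 = continuum `SU(2)` Yang–Mills on the three-torus at fixed lattice data — a RUNG: NOT d = 4, NOT infinite volume, NOT a mass gap,
NOT Clay).  Width seat `ym3-torus-px13` (gen 25); crux `stmt-QuantumFields-20520`, LINE g18-1 S2β; MULT♮ ⟸ (RINV-curl) ∧ BKG (✓p824141), (RINV-curl) ⟸ px16 g21's door
`…PreimagesOfFaceSpreads` over (B1)–(B5) + (D2).  `--kind proof --supports stmt-QuantumFields-20520 --as helper`, count-neutral, DEFINITION-FREE (0 `def`, 0 `instance`, 0 `notation`,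
0 `sorry`).  THIS FILE: the T³ ∕ quaternion-chart edition of (D2) — the form the door consumes at `κ := PBond (F.P J) 0`, `DM := fderiv ℝ Mc 0`.

WHAT IS PROVED (sorry-free).
* §1 `norm_coord_eq` (`‖⟨su2Coord (rev x), _⟩‖ = ‖x‖`), `norm_coordField_eq` (`‖(b ↦ ⟨su2Coord (rev (ζ b)), _⟩)‖_∞ = ‖ζ‖_∞`), `loopGuardAt_of_histGood` (per-level loop guard
  `α_i := (5L)²∕4·θ(K − i)` of a good history, `i < K − J`).
* §2 ★★★`norm_fderiv_chartRead_descendTo_expPoint_apply_le` — for `U₀ ∈ histGood F ℰp θ K J`, `0 ≤ θ`, and `(5L)²∕4·θ_h ≤ 1∕24`, `(5L)²∕4·θ_h < δ_{SU(2)}` at every height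
  `J < h ≤ K`: **`‖↑((fderiv ℝ Mc 0 ζ) B)‖ ≤ 21·exp(c₃·Σ_{i<K−J} (5L)²∕4·θ(K−i))·L^{K−J}·‖ζ‖_∞`**, `c₃ = 5·(422 + 1616·5) = 42510` (d = 3), for
  `Mc ζ B = Λ(descendTo F ℰp J K hJK (ℓ ↦ expPoint (ζ ℓ)·U₀ ℓ) B · (descendTo F ℰp J K hJK U₀ B)⁻¹)`.

HONEST.  Bookkeeping over (D2), (E) and a printed isometry; nothing of Bałaban's beyond what those files carry; the geometric profile `Σ_{J<h≤K} θ_h ≲ θBal(J)` (lit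
`T3Thresholds`) is NOT plugged here (px16's door does it); (RINV-curl), MULT♮, AVG₂♭-ax, «CRIT-ax», (D-ax), GAP♯∘ (registry UNTOUCHED), the five REGISTERED stubs, S2β, crux 20520,
19936, 19200 and `YM3TorusSU2` are NOT proved; no summit statement is proved by a helper; rung R3 = SU(2) YM₃ on T³ — NOT d = 4, NOT infinite volume, NOT a mass gap, NOT Clay; the
Yang–Mills mass gap is NOT proved.  Axioms standard.

References: T. Bałaban, CMP **98** (1985) 17–51 [Balaban1985Averaging] (Prop. 3–4 pp.36–37, (139)–(147) pp.39–40); CMP **102** (1985) 255–275 [Balaban1985UV3] ((7) p.257, p.260);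
CMP **109** (1987) 249–301 [Balaban1987RG1] ((0.11) p.253).
-/

set_option autoImplicit false

noncomputable section

open scoped BigOperators Matrix.Norms.L2Operator Topology
open Filter Set Function

namespace Summit.QuantumFields.YangMills.Theorems.FluctuationComparisonRegPrIntLS2BetaChartReadDescentDerivKStepSupT3

open Literature.MathematicalPhysics.QuantumFieldTheory.Balaban1983to89
open Literature.MathematicalPhysics.QuantumFieldTheory.Balaban1983to89.HaarExponentialChart
open Literature.MathematicalPhysics.QuantumFieldTheory.Balaban1983to89.HaarExponentialChart.IsChartRep
open Literature.MathematicalPhysics.QuantumFieldTheory.Balaban1983to89.BlockAveraging (Small Idx avgFun loopHol blockAvg blockAvg_avg)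
open Literature.MathematicalPhysics.QuantumFieldTheory.Balaban1983to89.ExpMeanLog (expMeanLogSU deltaSU)
open Literature.MathematicalPhysics.QuantumFieldTheory.Balaban1983to89.Node00
open Literature.MathematicalPhysics.QuantumFieldTheory.Balaban1983to89.T3ContinuumYM3Torus
open Literature.MathematicalPhysics.QuantumFieldTheory.Balaban1983to89.T3UnitLawDensityEML (ℰp)
open Literature.MathematicalPhysics.QuantumFieldTheory.Balaban1983to89.T3UnitScaleTilt
open Literature.MathematicalPhysics.QuantumFieldTheory.Balaban1983to89.T3TiltDescent
open Literature.MathematicalPhysics.QuantumFieldTheory.Balaban1983to89.T3LevelShift (fieldShift bondShift)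
open Literature.MathematicalPhysics.QuantumFieldTheory.Balaban1983to89.T4HaarSU2ExpChart (expPoint)
open Literature.MathematicalPhysics.QuantumFieldTheory.Balaban1983to89.B10Eq18SigmaSU2 (su2Coord)
open Literature.MathematicalPhysics.QuantumFieldTheory.Balaban1983to89.B10Eq18SigmaSU2Haar (rev norm_rev rev_rev quatMatrix_imQuat_rev)
open Literature.MathematicalPhysics.QuantumFieldTheory.Balaban1983to89.T4QuatExpLog (norm_quatMatrix)
open Literature.MathematicalPhysics.QuantumFieldTheory.Balaban1983to89.T4HaarSU2ExpChart (norm_imQuat)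
open Summit.QuantumFields.YangMills.Theorems.FluctuationComparisonRegPrIntLS2BetaChartReadDescentOntoExpPoint (su2Coord_rev_mem_lie)
open Summit.QuantumFields.YangMills.Theorems.FluctuationComparisonRegPrIntLS2BetaChartReadDescentOntoT3 (smallBelow_of_histGood)
open Summit.QuantumFields.YangMills.Theorems.FluctuationComparisonRegPrIntLS2BetaChartReadDescentDerivFactorisation (fderiv_chartRead_descendTo_expPoint_apply)
open Summit.QuantumFields.YangMills.Theorems.FluctuationComparisonRegPrIntLS2BetaChartReadDerivKStepSup (norm_fderiv_chartRead_iter_apply_le_exp)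

/-! ## §1 The Pauli isometry in the chart; the per-level loop guard of a good history -/

section Letters

/-- `‖⟨su2Coord (rev x), _⟩‖ = ‖x‖` (the chart norm is the operator norm of `M₂(ℂ)`: `su2Coord (rev x) = quatMatrix (ι x)`, `‖quatMatrix q‖ = ‖q‖`, `‖ι x‖ = ‖x‖` — the
ingredients of lit `B10Eq18SigmaSU2Window.norm_su2Coord`, whose module is not imported here). [cite: Balaban1985UV3, p. 260] -/
theorem norm_coord_eq (x : EuclideanSpace ℝ (Fin 3)) :
    ‖(⟨su2Coord (rev x), su2Coord_rev_mem_lie x⟩ : (specialUnitaryLogChart (Fin 2)).lie)‖ = ‖x‖ := by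
  rw [Submodule.coe_norm]
  show ‖su2Coord (rev x)‖ = ‖x‖
  rw [← quatMatrix_imQuat_rev, rev_rev, norm_quatMatrix, norm_imQuat]

/-- Bond-wise: `‖(b ↦ ⟨su2Coord (rev (ζ b)), _⟩)‖_∞ = ‖ζ‖_∞`. [cite: Balaban1985UV3, p. 260] -/
theorem norm_coordField_eq {ι : Type*} [Fintype ι] (ζ : ι → EuclideanSpace ℝ (Fin 3)) :
    ‖(fun b => (⟨su2Coord (rev (ζ b)), su2Coord_rev_mem_lie (ζ b)⟩ : (specialUnitaryLogChart (Fin 2)).lie))‖ = ‖ζ‖ := by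
  apply le_antisymm
  · refine (pi_norm_le_iff_of_nonneg (norm_nonneg ζ)).2 fun b => ?_
    rw [norm_coord_eq]; exact norm_le_pi_norm ζ b
  · refine (pi_norm_le_iff_of_nonneg (norm_nonneg _)).2 fun b => ?_
    rw [← norm_coord_eq (ζ b)]
    exact norm_le_pi_norm (fun b => (⟨su2Coord (rev (ζ b)), su2Coord_rev_mem_lie (ζ b)⟩ : (specialUnitaryLogChart (Fin 2)).lie)) b

variable {F : T3Family}

/-- THE PER-LEVEL LOOP GUARD OF A GOOD HISTORY: for `U₀ ∈ histGood F ℰp θ K J` and `0 ≤ θ`, at every fine level `i < K − J` the loop variables of `Ū^i U₀` are within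
`(5L)²∕4·θ(K − i)` of `1` (lit `LatticeWordStokes.dist1_loopHol_le`, `d = 3`). [cite: Balaban1985UV3, (7) p.257; Balaban1987RG1, (0.4) p.253] -/
theorem loopGuardAt_of_histGood {J K : ℕ} {θ : ℕ → ℝ} (hθ0 : ∀ i, 0 ≤ θ i)
    {U₀ : GaugeField (F.P K) 0 (SU 2)} (hUg : U₀ ∈ histGood F ℰp θ K J) :
    ∀ i, i < K - J → ∀ (c : PBond (F.P K) (i + 1)) (idx : Idx (F.P K)),
      dist1 (loopHol (Averaging.iter (fun i => blockAvg (P := F.P K) (j := i) (expMeanLogSU (n := Fin 2))) i U₀) c idx) ≤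
        (((5 * F.L : ℕ) : ℝ) ^ 2 / 4) * θ (K - i) := by
  intro i hi c idx
  have hsmall : PlaqSmall (θ (K - i)) (Averaging.iter (fun i => blockAvg (P := F.P K) (j := i) (expMeanLogSU (n := Fin 2))) i U₀) :=
    hUg i (by omega)
  have h := LatticeWordStokes.dist1_loopHol_le (hθ0 (K - i)) hsmall c idx
  have hd : ((((F.P K).d + 2) * (F.P K).L : ℕ) : ℝ) = ((5 * F.L : ℕ) : ℝ) := by
    show ((((3 + 2) * F.L : ℕ)) : ℝ) = ((5 * F.L : ℕ) : ℝ)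
    norm_num
  rw [hd] at h
  exact h

end Letters

/-! ## §2 ★★★ (D2) for the pinned `DM` -/

section Organ

variable {F : T3Family}

/-- ★★★ **(D2) AT THE ORGAN**: for a good history `U₀ ∈ histGood F ℰp θ K J` with `0 ≤ θ` and, at every height `J < h ≤ K`, `(5L)²∕4·θ_h ≤ 1∕24` and `(5L)²∕4·θ_h < δ_{SU(2)}`:
`‖↑((DM ζ) B)‖ ≤ (1 + 4·5)·exp(c₃·Σ_{i<K−J} (5L)²∕4·θ(K−i))·L^{K−J}·‖ζ‖_∞`, `c₃ = 5·(422 + 1616·5)`, `DM = fderiv ℝ Mc 0` the pinned derivative of the quaternion-read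
charted descent ((E) `fderiv_chartRead_descendTo_expPoint_apply` + (D2) `norm_fderiv_chartRead_iter_apply_le_exp` + the Pauli isometry).
[cite: Balaban1985Averaging, Prop. 3-4 pp.36-37, (139)-(147) pp.39-40; Balaban1985UV3, (7) p.257, p.260; Balaban1987RG1, (0.11) p.253] -/
theorem norm_fderiv_chartRead_descendTo_expPoint_apply_le {J K : ℕ} (hJK : J ≤ K) {θ : ℕ → ℝ} (hθ0 : ∀ i, 0 ≤ θ i)
    (hθ24 : ∀ h, J < h → h ≤ K → (((5 * F.L : ℕ) : ℝ) ^ 2 / 4) * θ h ≤ 1 / 24)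
    (hθδ : ∀ h, J < h → h ≤ K → (((5 * F.L : ℕ) : ℝ) ^ 2 / 4) * θ h < deltaSU (Fin 2))
    {U₀ : GaugeField (F.P K) 0 (SU 2)} (hUg : U₀ ∈ histGood F ℰp θ K J)
    (ζ : PBond (F.P K) 0 → EuclideanSpace ℝ (Fin 3)) (B : PBond (F.P J) 0) :
    ‖((fderiv ℝ (fun (ζ : PBond (F.P K) 0 → EuclideanSpace ℝ (Fin 3)) (B : PBond (F.P J) 0) =>
          (isChartRep_specialUnitaryGroup (n := Fin 2)).logChart
            (descendTo F ℰp J K hJK (fun ℓ => expPoint (ζ ℓ) * U₀ ℓ) B * (descendTo F ℰp J K hJK U₀ B)⁻¹)) 0 ζ B :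
          (specialUnitaryLogChart (Fin 2)).lie) : Matrix (Fin 2) (Fin 2) ℂ)‖ ≤
      (1 + 4 * (((F.P K).d + 2 : ℕ) : ℝ)) *
          Real.exp ((((F.P K).d + 2 : ℕ) : ℝ) * (422 + 1616 * (((F.P K).d + 2 : ℕ) : ℝ)) *
            ∑ i ∈ Finset.range (K - J), (((5 * F.L : ℕ) : ℝ) ^ 2 / 4) * θ (K - i)) *
        ((F.P K).L : ℝ) ^ (K - J) * ‖ζ‖ := by
  -- the per-level guard profile `α_i := (5L)²/4·θ(K − i)` (extended by `0` off `i < K − J`)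
  set α : ℕ → ℝ := fun i => if i < K - J then (((5 * F.L : ℕ) : ℝ) ^ 2 / 4) * θ (K - i) else 0 with hαdef
  have hα0 : ∀ i, 0 ≤ α i := by
    intro i; simp only [hαdef]; split_ifs
    · exact mul_nonneg (by positivity) (hθ0 _)
    · exact le_rfl
  have hα24 : ∀ i, α i ≤ 1 / 24 := by
    intro i; simp only [hαdef]; split_ifs with hi
    · exact hθ24 (K - i) (by omega) (by omega)
    · norm_num
  have hαδ : ∀ i, α i < deltaSU (Fin 2) := by
    intro i; simp only [hαdef]; split_ifs with hi
    · exact hθδ (K - i) (by omega) (by omega)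
    · exact ExpMeanLog.deltaSU_pos
  have hα : ∀ i, i < K - J → ∀ (c : PBond (F.P K) (i + 1)) (idx : Idx (F.P K)),
      dist1 (loopHol (Averaging.iter (fun i => blockAvg (P := F.P K) (j := i) (expMeanLogSU (n := Fin 2))) i U₀) c idx) ≤ α i := by
    intro i hi c idx
    have h := loopGuardAt_of_histGood (F := F) hθ0 hUg i hi c idx
    simp only [hαdef, if_pos hi]
    exact h
  -- guard-only consequences for (E)
  have hθδ' : ∀ h, J < h → h ≤ K → (((5 * F.L : ℕ) : ℝ) ^ 2 / 4) * θ h < deltaSU (Fin 2) := hθδ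
  rw [fderiv_chartRead_descendTo_expPoint_apply (F := F) hJK hθ0 hθδ' hUg ζ B]
  have hmain := norm_fderiv_chartRead_iter_apply_le_exp (P := F.P K) (N := 2) U₀
    (fun b => (⟨su2Coord (rev (ζ b)), su2Coord_rev_mem_lie (ζ b)⟩ : (specialUnitaryLogChart (Fin 2)).lie)) hα0 hα24 hαδ (K - J) hα
    (bondShift (F.sitesPerDir_eq (m := F.m) (K := J) (j := 0) (m' := F.m) (K' := K) (j' := K - J) (by omega)) B)
  rw [norm_coordField_eq] at hmain
  refine hmain.trans (le_of_eq ?_)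
  have hsum : ∑ j ∈ Finset.range (K - J), α j = ∑ i ∈ Finset.range (K - J), (((5 * F.L : ℕ) : ℝ) ^ 2 / 4) * θ (K - i) :=
    Finset.sum_congr rfl fun i hi => by simp only [hαdef, if_pos (Finset.mem_range.1 hi)]
  rw [hsum]

end Organ

end Summit.QuantumFields.YangMills.Theorems.FluctuationComparisonRegPrIntLS2BetaChartReadDescentDerivKStepSupT3

end
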